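import Literature.AlgebraicGeometry.AbelianSchemes.SerreTensorFunctoriality     -- ★ `serreMap` (+ `_ι`, `isMonHom_`, `_id`, `_comp`, `serreAction_comp_serreMap`), `powMap`
import Literature.AlgebraicGeometry.AbelianSchemes.SerreTwistPolarization       -- ★ `serreTranslate`∕`serreTranslateInv` (+ presentations), `serreTwistLamPull`, `IsExactTwistPol`, dual isogenies
import Literature.AlgebraicGeometry.AbelianSchemes.SerreTwistLevel              -- ★ `LevelStructure`, `LevelStructure.existsUnique_serreTwist`
import Literature.AlgebraicGeometry.AbelianSchemes.SerreTensorBaseChange        -- ★ `serreTensorBaseChangeIso` (+ `_hom_ι`), `powBC`, `ιBC`, `RingAction.baseChange`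
import HarnessLib

/-!
# The Serre tensor `A ⊗_𝒪 𝔟` is functorial in STRUCTURED ISOMORPHISMS: an `𝒪`-equivariant isomorphism `ε : A₁ ⥲ A₂` exact on `(λ, level)` induces
# `ε ⊗ 𝔟 : A₁ ⊗_𝒪 𝔟 ⥲ A₂ ⊗_𝒪 𝔟`, equivariant, intertwining the translates `ψ_P` and the covers `ψ′`, exact on the twisted polarisations and levels

Topic `AlgebraicGeometry/AbelianSchemes`; namespace `Literature.AlgebraicGeometry.AbelianSchemes.AbelianSchemeOver`.  THEOREMS ONLY (no definition, no named
fact, no instance, no notation, no `sorry`); ANY base scheme `S` (§4 (iii-exact) over a reduced locally Noetherian base, where dual homomorphisms are homomorphisms).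
Cell `hodgecm-mathlib` (D-0151), P6 «MOD programme», half A line L2 (closer leaf `Lines/F0_P6a_StubDOWN.lean` of the D-LINE socket `stub_DOWN`): LA2-plan (g0)
DEAL (ST) «SERRE-TRANSLATE REDUCES FUNCTORIALLY» 2026-09-02T04:12:30Z — the Literature input of the LS leaflet §3b `red₀Of_translΩ_eq_of_red₀Of_eq` (the L2 law
`RedTranslLaw`: «`red₀ (translΩ y)` depends only on `red₀ y`») and of `stub_TRANSLWD`, composed downstream with ★ `RoofTargetUnique` (p849047) and ★
`SerreTensorUntwist`.  `--supports stmt-HodgeConjecture-24832`, count-neutral.  HONEST LABEL: HC_CM is proved only modulo the 2 remaining named inputs (hLiu418 24832,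
h413 24833) until rung 0 closes; this file is general and discharges none of them.

THE MATHEMATICS ([Conrad2004GrossZagier] §7: `M ⊗_𝒪 (·)` is a functor on `𝒪`-abelian schemes, Thm. 7.5 for the translate `A → A ⊗ 𝔞⁻¹`; [MumfordAV1970] §15 Thm. 1
`(ψ ≫ χ)^∨ = χ^∨ ≫ ψ^∨`, §23; [RapoportSmithlingZhang2020Diagonal] §3.2 ∕ (4.23): the Serre twist `(A ⊗ 𝔞⁻¹, ι, λ_𝔞, η_𝔞)` of a PEL tuple; [MumfordFogartyKirwan1994]
Ch. 7 §2 Def. 7.2–7.3 «tuples up to isomorphism»).  Let `𝔟 = E′·𝒪ᵐ` be a presented module with an element `P` (`E′P = P`) and a row `Q` (`QE′ = Q`), and let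
`g : A₁ → A₂` be an `𝒪`-EQUIVARIANT HOMOMORPHISM of commutative abelian `S`-schemes with `𝒪`-actions.  ★ `serreMap` gives `g ⊗ 𝔟 : A₁ ⊗ 𝔟 → A₂ ⊗ 𝔟`, functorial and
equivariant.  NEW here: (§1) `g ⊗ (·)` is NATURAL IN THE MODULE MAP — `(g ⊗ 𝔟) ≫ (A₂ ⊗ P) = (A₁ ⊗ P) ≫ (g ⊗ 𝔟′)` for every presentation map `P : 𝔟 → 𝔟′`
(★ `serrePresentationHom`; coordinates: `(∏_k x_k ι(P_{jk})) ≫ g = ∏_k (x_k ≫ g) ι(P_{jk})`), whence (§2) `g` INTERTWINES THE TRANSLATES AND THE COVERS: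
`ψ_P ≫ (g ⊗ 𝔟) = g ≫ ψ_P`, `ψ′ ≫ g = (g ⊗ 𝔟) ≫ ψ′` (★ `serreTranslate` = `(A ⊗ 𝒪 ≅ A)⁻¹ ≫ (A ⊗ P)`, ★ `serreTranslateInv` = `(A ⊗ Q) ≫ (A ⊗ 𝒪 ≅ A)`).  For an
equivariant ISOMORPHISM `ε : A₁ ⥲ A₂` (§3) `ε ⊗ 𝔟` and `ε⁻¹ ⊗ 𝔟` are mutually inverse (`serreMap_comp`, `serreMap_id`), so there is a STRUCTURED ISOMORPHISM
`ẽ : A₁ ⊗ 𝔟 ⥲ A₂ ⊗ 𝔟` — homomorphic both ways, `𝒪`-equivariant, intertwining `ψ_P` and `ψ′` — and (§4) it is EXACT ON THE TWISTED STRUCTURES whenever `ε` is exact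
on the original ones: if `ε ≫ λ₂ ≫ ε^∨ = λ₁` then (iii-pull) `ẽ ≫ (ψ′₂ ≫ λ₂ ≫ ψ′₂^∨) ≫ ẽ^∨ = ψ′₁ ≫ λ₁ ≫ ψ′₁^∨` (★ `serreTwistLamPull`) and (iii-exact) every `c`-EXACT
twisted polarisation `λ₂′` (`ψ_P ≫ λ₂′ ≫ ψ_P^∨ = λ₂ ≫ [c]`, ★ `IsExactTwistPol`) pulls back to a `c`-exact one `ẽ ≫ λ₂′ ≫ ẽ^∨` for `λ₁` — hence EQUALS the exact
twist `λ₁′` by ★ `IsExactTwistPol.eq` — both by `(ψ ≫ χ)^∨ = χ^∨ ≫ ψ^∨` (★ `dualIsogenyOver_comp`) and the intertwining of §2; (iv) the twisted level sections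
`σ′ᵢ = σᵢ ≫ ψ_P` (★ `LevelStructure.existsUnique_serreTwist`) correspond under `ẽ` when the `σᵢ` correspond under `ε`.  So «structured iso of fibres ⇒ structured
iso of their Serre translates» — with ★ `RoofTargetUnique` (structured iso of roof middles) and ★ `SerreTensorUntwist` (the converse descent) this is the
functorial half of «`red₀ (translΩ y)` depends only on `red₀ y`».

## Contents (`actᵢ : 𝒪 → End Aᵢ`, `IsCommMonObj Aᵢ.X`; `E′ hE′ P Q` one presentation used on both sides; `g` equivariant homomorphism, `ε` equivariant iso)
* §1 `matrixHom_comp_powMap` (`[P] ≫ gᵐ = gⁿ ≫ [P]′`, rectangular `P`), **`serreMap_comp_serrePresentationHom`** (naturality of `A ⊗ P` in `A`),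
  `serreMap_comp_serreTensorOneIso_hom`, `serreTensorOneIso_inv_comp_serreMap` (`A ⊗ 𝒪 ≅ A` is natural).
* §2 **`serreTranslate_comp_serreMap`** (`ψ_P ≫ (g ⊗ 𝔟) = g ≫ ψ_P`), **`serreTranslateInv_comp_eq_serreMap_comp`** (`ψ′ ≫ g = (g ⊗ 𝔟) ≫ ψ′`).
* §3 `i_comp_inv_of_equivariant` (`ε⁻¹` is equivariant), `serreMap_hom_comp_serreMap_inv`∕`serreMap_inv_comp_serreMap_hom`,
  **`exists_serreTensor_iso_of_equivariant_iso`** (`∃ ẽ`, `ẽ.hom = ε ⊗ 𝔟`, `ẽ.inv = ε⁻¹ ⊗ 𝔟`, homomorphic, equivariant, intertwining `ψ_P`, `ψ′`).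
* §4 (iii-pull) **`serreMap_comp_serreTwistLamPull_comp_dualIsogenyOver`**; (iii-exact) **`isExactTwist_transport`** (raw form, reduced locally Noetherian base) and
  **`IsExactTwistPol.transport`** (★ def currency); (iv) `comp_serreTranslate_comp_serreMap` (any `T`-point), **`LevelStructure.serreTwist_σ_comp_serreMap`**.
* §5 `baseChange_map_equivariant`, `pullback_map_powMap_comp_powBC` (`powBC` natural in `A`),
  **`pullback_map_serreMap_comp_serreTensorBaseChangeIso`** (THE BASE-CHANGE SQUARE `(φ ⊗ 𝔟)_{S′} ≫ iso₂ = iso₁ ≫ (φ_{S′} ⊗ 𝔟)`).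

## References
* [Conrad2004GrossZagier] B. Conrad, *Gross–Zagier revisited*, MSRI Publ. 49 (2004), §7 (Thm. 7.5).
* [MumfordAV1970] D. Mumford, *Abelian Varieties* (1970), §15 Thm. 1 (p. 143); §23 (Thm. 2, p. 231).
* [RapoportSmithlingZhang2020Diagonal] M. Rapoport, B. Smithling, W. Zhang, *Arithmetic diagonal cycles on unitary Shimura varieties*, Compos. Math. 156 (2020), §3.2 and (4.23).
* [MumfordFogartyKirwan1994] D. Mumford, J. Fogarty, F. Kirwan, *Geometric Invariant Theory*, 3rd ed. (1994), Ch. 7 §2 Def. 7.2 (p. 129), Def. 7.3 (p. 130).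
* [Kottwitz1992] R. Kottwitz, *Points on some Shimura varieties over finite fields*, JAMS 5 (1992), §5 (p. 390).
* [GortzWedhorn2020] U. Görtz, T. Wedhorn, *Algebraic Geometry I*, 2nd ed. (2020), Section (4.7) (pp. 107–108) (base change of group schemes).
* Tree: ★ `SerreTensorFunctoriality`, ★ `SerreTensorPresentation`∕`SerreTensorModuleMap`, ★ `SerreTensorIdealTranslationKernel`∕`…QuasiInverse`, ★ `SerreTwistPolarization`,
  ★ `SerreTwistLevel`, ★ `AbelianSchemeDualIsogenyComp`, ★ `RoofTargetUnique`, ★ `SerreTensorUntwist`.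
-/

set_option autoImplicit false

noncomputable section

-- Mathlib's `Over`/pull-back API and `Scheme.Modules` are stated across semireducible wrappers (as in the ★ `AbelianSchemes/*` files).
set_option backward.isDefEq.respectTransparency false

universe u

open CategoryTheory CategoryTheory.Limits AlgebraicGeometry MonoidalCategory CartesianMonoidalCategory
open scoped MonObj

namespace Literature.AlgebraicGeometry.AbelianSchemes

namespace AbelianSchemeOver

variable {S : Scheme.{u}} {A₁ A₂ : AbelianSchemeOver S} {O : Type*} [CommRing O] (act₁ : A₁.RingAction O) (act₂ : A₂.RingAction O)
  [IsCommMonObj A₁.X] [IsCommMonObj A₂.X]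

/-! ### §1 `g ⊗ (·)` is natural in the module map: `(g ⊗ 𝔟) ≫ (A₂ ⊗ P) = (A₁ ⊗ P) ≫ (g ⊗ 𝔟′)` -/

section Naturality

variable (g : A₁.X ⟶ A₂.X) [IsMonHom g] (hg : ∀ a, act₁.i a ≫ g = g ≫ act₂.i a)

include hg in
/-- **`[P] ≫ gᵐ = gⁿ ≫ [P]′`** for a rectangular `P ∈ M_{m×n}(𝒪)` and an `𝒪`-equivariant homomorphism `g` (coordinates: `(∏_k x_k ≫ ι₁(P_{jk})) ≫ g =
∏_k (x_k ≫ g) ≫ ι₂(P_{jk})`; the square case is ★ `matrixEnd_comp_powMap`). [cite: Kottwitz1992, §5 (p. 390)] [cite: Conrad2004GrossZagier, §7] -/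
theorem matrixHom_comp_powMap {m n : ℕ} (P : Matrix (Fin m) (Fin n) O) :
    matrixHom act₁ P ≫ powMap g m = powMap g n ≫ matrixHom act₂ P := by
  apply (powHomEquiv A₂ m _).injective
  funext j
  rw [powHomEquiv_comp_powMap, ← Category.id_comp (matrixHom act₁ P), powHomEquiv_comp_matrixHom, powHomEquiv_comp_matrixHom]
  unfold matrixCompRect
  rw [finset_prod_comp]
  refine Finset.prod_congr rfl fun k _ => ?_
  rw [Category.assoc, hg, ← Category.assoc, ← powHomEquiv_comp_powMap, Category.id_comp]

include hg in
/-- **NATURALITY OF `A ⊗ P` IN `A`**: for presentations `𝔟 = E·𝒪ⁿ`, `𝔟′ = E′·𝒪ᵐ` and a module map `P` (`E′P = PE`), the Serre maps of an equivariant homomorphism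
`g : A₁ → A₂` commute with the presentation homomorphisms: `(g ⊗ 𝔟) ≫ (A₂ ⊗ P) = (A₁ ⊗ P) ≫ (g ⊗ 𝔟′)` (check after the monomorphism `ι′`: both are
`ι ≫ gⁿ ≫ [P]′ = ι ≫ [P] ≫ gᵐ`). [cite: Conrad2004GrossZagier, §7] -/
@[reassoc]
theorem serreMap_comp_serrePresentationHom {m n : ℕ} (E : Matrix (Fin n) (Fin n) O) (hE : E * E = E) (E' : Matrix (Fin m) (Fin m) O) (hE' : E' * E' = E')
    (P : Matrix (Fin m) (Fin n) O) (hP : E' * P = P * E) :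
    serreMap act₁ act₂ E hE g ≫ serrePresentationHom act₂ E hE E' hE' P = serrePresentationHom act₁ E hE E' hE' P ≫ serreMap act₁ act₂ E' hE' g := by
  haveI := (isMonHom_serreι_serreπ act₂ E' hE').2.2
  rw [← cancel_mono (serreι act₂ E' hE'), Category.assoc, serrePresentationHom_ι_of act₂ E hE E' hE' P hP, serreMap_ι_assoc act₁ act₂ E hE g hg,
    Category.assoc, serreMap_ι act₁ act₂ E' hE' g hg, serrePresentationHom_ι_of_assoc act₁ E hE E' hE' P hP, matrixHom_comp_powMap act₁ act₂ g hg P]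

include hg in
/-- **`A ⊗_𝒪 𝒪 ≅ A` IS NATURAL**: `(g ⊗ 𝒪) ≫ (A₂ ⊗ 𝒪 ≅ A₂) = (A₁ ⊗ 𝒪 ≅ A₁) ≫ g` (`hom = ι ≫ pr₀`, ★ `serreMap_ι`, ★ `powMap_powProj`). [cite: Conrad2004GrossZagier, §7] -/
@[reassoc]
theorem serreMap_comp_serreTensorOneIso_hom :
    serreMap act₁ act₂ (1 : Matrix (Fin 1) (Fin 1) O) one_mul_one_fin_one g ≫ (serreTensorOneIso act₂).hom = (serreTensorOneIso act₁).hom ≫ g := by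
  change serreMap act₁ act₂ 1 one_mul_one_fin_one g ≫ serreι act₂ 1 one_mul_one_fin_one ≫ A₂.powProj 1 0 =
    (serreι act₁ 1 one_mul_one_fin_one ≫ A₁.powProj 1 0) ≫ g
  rw [serreMap_ι_assoc act₁ act₂ 1 one_mul_one_fin_one g hg, powMap_powProj, Category.assoc]

include hg in
/-- … equivalently `(A₁ ⊗ 𝒪 ≅ A₁)⁻¹ ≫ (g ⊗ 𝒪) = g ≫ (A₂ ⊗ 𝒪 ≅ A₂)⁻¹`. [cite: Conrad2004GrossZagier, §7] -/
@[reassoc]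
theorem serreTensorOneIso_inv_comp_serreMap :
    (serreTensorOneIso act₁).inv ≫ serreMap act₁ act₂ (1 : Matrix (Fin 1) (Fin 1) O) one_mul_one_fin_one g = g ≫ (serreTensorOneIso act₂).inv := by
  rw [Iso.inv_comp_eq, ← Category.assoc, ← serreMap_comp_serreTensorOneIso_hom act₁ act₂ g hg, Category.assoc, Iso.hom_inv_id, Category.comp_id]

end Naturality

/-! ### §2 An equivariant homomorphism intertwines the ideal translations `ψ_P` and the covers `ψ′` -/

section Translates

variable {m : ℕ} (E' : Matrix (Fin m) (Fin m) O) (hE' : E' * E' = E') (P : Matrix (Fin m) (Fin 1) O) (Q : Matrix (Fin 1) (Fin m) O)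
  (g : A₁.X ⟶ A₂.X) [IsMonHom g] (hg : ∀ a, act₁.i a ≫ g = g ≫ act₂.i a)

include hg in
/-- **`ψ_P ≫ (g ⊗ 𝔟) = g ≫ ψ_P`**: an `𝒪`-equivariant homomorphism intertwines the ideal translations `ψ_P : Aᵢ → Aᵢ ⊗_𝒪 𝔟` (`E′P = P`).
[cite: Conrad2004GrossZagier, §7 (Thm. 7.5)] -/
@[reassoc]
theorem serreTranslate_comp_serreMap (hP : E' * P = P) :
    serreTranslate act₁ E' hE' P ≫ serreMap act₁ act₂ E' hE' g = g ≫ serreTranslate act₂ E' hE' P := by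
  have hP' : E' * P = P * (1 : Matrix (Fin 1) (Fin 1) O) := by rw [Matrix.mul_one]; exact hP
  rw [serreTranslate, serreTranslate, Category.assoc, ← serreMap_comp_serrePresentationHom act₁ act₂ g hg 1 one_mul_one_fin_one E' hE' P hP',
    serreTensorOneIso_inv_comp_serreMap_assoc act₁ act₂ g hg]

include hg in
/-- **`ψ′ ≫ g = (g ⊗ 𝔟) ≫ ψ′`**: an `𝒪`-equivariant homomorphism intertwines the covers `ψ′ : Aᵢ ⊗_𝒪 𝔟 → Aᵢ` (`QE′ = Q`). [cite: Conrad2004GrossZagier, §7 (Thm. 7.5)] -/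
theorem serreTranslateInv_comp_eq_serreMap_comp (hQ : Q * E' = Q) :
    serreTranslateInv act₁ E' hE' Q ≫ g = serreMap act₁ act₂ E' hE' g ≫ serreTranslateInv act₂ E' hE' Q := by
  have hQ' : (1 : Matrix (Fin 1) (Fin 1) O) * Q = Q * E' := by rw [Matrix.one_mul]; exact hQ.symm
  rw [serreTranslateInv, serreTranslateInv, Category.assoc, ← serreMap_comp_serreTensorOneIso_hom act₁ act₂ g hg,
    serreMap_comp_serrePresentationHom_assoc act₁ act₂ g hg E' hE' 1 one_mul_one_fin_one Q hQ']

include hg in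
/-- (iv), `T`-point form: **`(x ≫ ψ_P) ≫ (g ⊗ 𝔟) = (x ≫ g) ≫ ψ_P`** — points translated then moved are points moved then translated (the twisted level rows
`σ′ = σ ≫ ψ_P` correspond under `g ⊗ 𝔟` when the `σ` correspond under `g`). [cite: RapoportSmithlingZhang2020Diagonal, §3.2 and (4.23)] -/
theorem comp_serreTranslate_comp_serreMap (hP : E' * P = P) {T : Over S} (x : T ⟶ A₁.X) :
    (x ≫ serreTranslate act₁ E' hE' P) ≫ serreMap act₁ act₂ E' hE' g = (x ≫ g) ≫ serreTranslate act₂ E' hE' P := by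
  rw [Category.assoc, serreTranslate_comp_serreMap act₁ act₂ E' hE' P g hg hP, Category.assoc]

include hg in
/-- (iv), level form: if `lvlᵢ′` are the Serre twists of `lvlᵢ` (`lvlᵢ′.σ = lvlᵢ.σ ≫ ψ_P`, ★ `LevelStructure.existsUnique_serreTwist`) and `g` carries `lvl₁.σ` to `lvl₂.σ`,
then `g ⊗ 𝔟` carries `lvl₁′.σ` to `lvl₂′.σ`. [cite: RapoportSmithlingZhang2020Diagonal, §3.2 and (4.23)] [cite: MumfordFogartyKirwan1994, Ch. 7 §2 Definition 7.3 (p. 130)] -/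
theorem LevelStructure.serreTwist_σ_comp_serreMap (hP : E' * P = P) {gdim n : ℕ} (lvl₁ : A₁.LevelStructure gdim n) (lvl₂ : A₂.LevelStructure gdim n)
    (lvl₁' : (serreTensor act₁ E' hE').LevelStructure gdim n) (lvl₂' : (serreTensor act₂ E' hE').LevelStructure gdim n)
    (h : ∀ i, lvl₁.σ i ≫ g = lvl₂.σ i) (h₁ : ∀ i, lvl₁'.σ i = lvl₁.σ i ≫ serreTranslate act₁ E' hE' P)
    (h₂ : ∀ i, lvl₂'.σ i = lvl₂.σ i ≫ serreTranslate act₂ E' hE' P) (i : Fin gdim ⊕ Fin gdim) :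
    lvl₁'.σ i ≫ serreMap act₁ act₂ E' hE' g = lvl₂'.σ i := by
  rw [h₁ i, h₂ i, comp_serreTranslate_comp_serreMap act₁ act₂ E' hE' P g hg hP, h i]

end Translates

/-! ### §3 The structured isomorphism `ε ⊗ 𝔟 : A₁ ⊗_𝒪 𝔟 ⥲ A₂ ⊗_𝒪 𝔟` of an equivariant isomorphism `ε : A₁ ⥲ A₂` -/

section IsoTensor

variable {n : ℕ} (E : Matrix (Fin n) (Fin n) O) (hE : E * E = E) (ε : A₁.X ≅ A₂.X) [IsMonHom ε.hom] (hε : ∀ a, act₁.i a ≫ ε.hom = ε.hom ≫ act₂.i a)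

omit [IsCommMonObj A₁.X] [IsCommMonObj A₂.X] [IsMonHom ε.hom] in
include hε in
/-- The inverse of an equivariant isomorphism is equivariant. [cite: MumfordFogartyKirwan1994, Ch. 7 §2 Definition 7.2 (p. 129)] -/
theorem i_comp_inv_of_equivariant (a : O) : act₂.i a ≫ ε.inv = ε.inv ≫ act₁.i a := by
  rw [Iso.comp_inv_eq, Category.assoc, hε a, Iso.inv_hom_id_assoc]

include hε in
/-- `(ε ⊗ 𝔟) ≫ (ε⁻¹ ⊗ 𝔟) = 𝟙` (★ `serreMap_comp`, ★ `serreMap_id`). [cite: Conrad2004GrossZagier, §7] -/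
theorem serreMap_hom_comp_serreMap_inv : serreMap act₁ act₂ E hE ε.hom ≫ serreMap act₂ act₁ E hE ε.inv = 𝟙 _ := by
  rw [← serreMap_comp act₁ act₂ act₁ E hE ε.hom hε ε.inv (i_comp_inv_of_equivariant act₁ act₂ ε hε), Iso.hom_inv_id, serreMap_id]

include hε in
/-- `(ε⁻¹ ⊗ 𝔟) ≫ (ε ⊗ 𝔟) = 𝟙`. [cite: Conrad2004GrossZagier, §7] -/
theorem serreMap_inv_comp_serreMap_hom : serreMap act₂ act₁ E hE ε.inv ≫ serreMap act₁ act₂ E hE ε.hom = 𝟙 _ := by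
  rw [← serreMap_comp act₂ act₁ act₂ E hE ε.inv (i_comp_inv_of_equivariant act₁ act₂ ε hε) ε.hom hε, Iso.inv_hom_id, serreMap_id]

end IsoTensor

section IsoTranslate

variable {m : ℕ} (E' : Matrix (Fin m) (Fin m) O) (hE' : E' * E' = E') (P : Matrix (Fin m) (Fin 1) O) (Q : Matrix (Fin 1) (Fin m) O)
  (ε : A₁.X ≅ A₂.X) [IsMonHom ε.hom] (hε : ∀ a, act₁.i a ≫ ε.hom = ε.hom ≫ act₂.i a)

include hε in
/-- **THE STRUCTURED ISOMORPHISM OF SERRE TENSORS INDUCED BY A STRUCTURED ISOMORPHISM** `ε : A₁ ⥲ A₂` (homomorphic, `𝒪`-equivariant): there is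
`ẽ : A₁ ⊗_𝒪 𝔟 ⥲ A₂ ⊗_𝒪 𝔟` (binder `et`) with `ẽ.hom = ε ⊗ 𝔟`, `ẽ.inv = ε⁻¹ ⊗ 𝔟` (★ `serreMap`), BOTH HOMOMORPHISMS, `𝒪`-EQUIVARIANT for the Serre actions, INTERTWINING THE
TRANSLATES (`ψ_P ≫ ẽ = ε ≫ ψ_P`, `E′P = P`) AND THE COVERS (`ψ′ ≫ ε = ẽ ≫ ψ′`, `QE′ = Q`) — so every datum read through `ψ_P`∕`ψ′` (exact twisted polarisation,
twisted level: §4) moves along. [cite: Conrad2004GrossZagier, §7 (Thm. 7.5)] [cite: MumfordFogartyKirwan1994, Ch. 7 §2 Definition 7.2 (p. 129) and Definition 7.3 (p. 130)]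
[cite: RapoportSmithlingZhang2020Diagonal, §3.2 and (4.23)] -/
theorem exists_serreTensor_iso_of_equivariant_iso (hP : E' * P = P) (hQ : Q * E' = Q) :
    ∃ et : (serreTensor act₁ E' hE').X ≅ (serreTensor act₂ E' hE').X,
      et.hom = serreMap act₁ act₂ E' hE' ε.hom ∧ et.inv = serreMap act₂ act₁ E' hE' ε.inv ∧ IsMonHom et.hom ∧ IsMonHom et.inv ∧
      (∀ a, (serreAction act₁ E' hE').i a ≫ et.hom = et.hom ≫ (serreAction act₂ E' hE').i a) ∧
      serreTranslate act₁ E' hE' P ≫ et.hom = ε.hom ≫ serreTranslate act₂ E' hE' P ∧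
      serreTranslateInv act₁ E' hE' Q ≫ ε.hom = et.hom ≫ serreTranslateInv act₂ E' hE' Q := by
  haveI : IsMonHom ε.inv := inferInstance
  exact ⟨⟨serreMap act₁ act₂ E' hE' ε.hom, serreMap act₂ act₁ E' hE' ε.inv, serreMap_hom_comp_serreMap_inv act₁ act₂ E' hE' ε hε,
      serreMap_inv_comp_serreMap_hom act₁ act₂ E' hE' ε hε⟩, rfl, rfl, isMonHom_serreMap act₁ act₂ E' hE' ε.hom,
    isMonHom_serreMap act₂ act₁ E' hE' ε.inv, fun a => serreAction_comp_serreMap act₁ act₂ E' hE' ε.hom hε a,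
    serreTranslate_comp_serreMap act₁ act₂ E' hE' P ε.hom hε hP, serreTranslateInv_comp_eq_serreMap_comp act₁ act₂ E' hE' Q ε.hom hε hQ⟩

end IsoTranslate

/-! ### §4 Exactness on the twisted polarisations -/

section Polarisation

variable {m : ℕ} (E' : Matrix (Fin m) (Fin m) O) (hE' : E' * E' = E') (P : Matrix (Fin m) (Fin 1) O) (Q : Matrix (Fin 1) (Fin m) O)
  (D₁ : A₁.DualPair) (D₂ : A₂.DualPair) (Db₁ : (serreTensor act₁ E' hE').DualPair) (Db₂ : (serreTensor act₂ E' hE').DualPair)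
  (lam₁ : A₁.X ⟶ D₁.hat.X) (lam₂ : A₂.X ⟶ D₂.hat.X)
  (g : A₁.X ⟶ A₂.X) [IsMonHom g] (hg : ∀ a, act₁.i a ≫ g = g ≫ act₂.i a)

include hg in
/-- **(iii-pull) THE PULL-BACK TWISTS CORRESPOND**: if `g ≫ λ₂ ≫ g^∨ = λ₁` then `(g ⊗ 𝔟) ≫ (ψ′₂ ≫ λ₂ ≫ ψ′₂^∨) ≫ (g ⊗ 𝔟)^∨ = ψ′₁ ≫ λ₁ ≫ ψ′₁^∨` — the raw form of
«`ẽ` is exact on ★ `serreTwistLamPull`» (`ψ′₁ ≫ g = (g ⊗ 𝔟) ≫ ψ′₂`, §2; `ψ′₂^∨ ≫ (g ⊗ 𝔟)^∨ = ((g ⊗ 𝔟) ≫ ψ′₂)^∨ = (ψ′₁ ≫ g)^∨ = g^∨ ≫ ψ′₁^∨`, ★ `dualIsogenyOver_comp`).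
Any base; `g` need not be an isomorphism. [cite: MumfordAV1970, §15 Thm. 1 (p. 143); §23 (Thm. 2, p. 231)] [cite: RapoportSmithlingZhang2020Diagonal, §3.2 and (4.23)] -/
theorem serreMap_comp_serreTwistLamPull_comp_dualIsogenyOver (hQ : Q * E' = Q)
    (hlam : g ≫ lam₂ ≫ DualPair.dualIsogenyOver g D₁ D₂ = lam₁) :
    haveI := isMonHom_serreMap act₁ act₂ E' hE' g
    haveI := isMonHom_serreTranslateInv act₁ E' hE' Q
    haveI := isMonHom_serreTranslateInv act₂ E' hE' Q
    serreMap act₁ act₂ E' hE' g ≫ (serreTranslateInv act₂ E' hE' Q ≫ lam₂ ≫ DualPair.dualIsogenyOver (serreTranslateInv act₂ E' hE' Q) Db₂ D₂) ≫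
        DualPair.dualIsogenyOver (serreMap act₁ act₂ E' hE' g) Db₁ Db₂ =
      serreTranslateInv act₁ E' hE' Q ≫ lam₁ ≫ DualPair.dualIsogenyOver (serreTranslateInv act₁ E' hE' Q) Db₁ D₁ := by
  haveI := isMonHom_serreMap act₁ act₂ E' hE' g
  haveI := isMonHom_serreTranslateInv act₁ E' hE' Q
  haveI := isMonHom_serreTranslateInv act₂ E' hE' Q
  have hnat : serreTranslateInv act₁ E' hE' Q ≫ g = serreMap act₁ act₂ E' hE' g ≫ serreTranslateInv act₂ E' hE' Q :=
    serreTranslateInv_comp_eq_serreMap_comp act₁ act₂ E' hE' Q g hg hQ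
  -- `ψ′₂^∨ ≫ (g ⊗ 𝔟)^∨ = g^∨ ≫ ψ′₁^∨`
  have hdual : DualPair.dualIsogenyOver (serreTranslateInv act₂ E' hE' Q) Db₂ D₂ ≫ DualPair.dualIsogenyOver (serreMap act₁ act₂ E' hE' g) Db₁ Db₂ =
      DualPair.dualIsogenyOver g D₁ D₂ ≫ DualPair.dualIsogenyOver (serreTranslateInv act₁ E' hE' Q) Db₁ D₁ := by
    rw [← DualPair.dualIsogenyOver_comp (serreMap act₁ act₂ E' hE' g) (serreTranslateInv act₂ E' hE' Q) Db₁ Db₂ D₂,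
      ← DualPair.dualIsogenyOver_comp (serreTranslateInv act₁ E' hE' Q) g Db₁ D₁ D₂]
    exact DualPair.dualIsogenyOver_congr Db₁ D₂ hnat.symm
  simp only [Category.assoc]
  rw [hdual, ← Category.assoc (serreMap act₁ act₂ E' hE' g), ← hnat, Category.assoc, ← hlam]
  simp only [Category.assoc]

include hg in
/-- **(iii-exact) EXACT TWISTED POLARISATIONS PULL BACK TO EXACT TWISTED POLARISATIONS** (reduced locally Noetherian base, where `g^∨` is a homomorphism and so commutes
with `[c]`): if `g ≫ λ₂ ≫ g^∨ = λ₁` and `λ₂′` is `c`-exact for `λ₂` (`ψ_P ≫ λ₂′ ≫ ψ_P^∨ = λ₂ ≫ [c]`) then `(g ⊗ 𝔟) ≫ λ₂′ ≫ (g ⊗ 𝔟)^∨` is `c`-exact for `λ₁`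
(`ψ_P ≫ (g ⊗ 𝔟) = g ≫ ψ_P`, §2; `(g ⊗ 𝔟)^∨ ≫ ψ_P^∨ = (ψ_P ≫ (g ⊗ 𝔟))^∨ = (g ≫ ψ_P)^∨ = ψ_P^∨ ≫ g^∨`).  With ★ `IsExactTwistPol.eq` the pull-back therefore EQUALS any
`c`-exact twist of `λ₁`. [cite: RapoportSmithlingZhang2020Diagonal, §3.2 and (4.23)] [cite: MumfordAV1970, §15 Thm. 1 (p. 143); §23 (Thm. 2, p. 231)] -/
theorem isExactTwist_transport [IsReduced S] [IsLocallyNoetherian S]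
    (hD₁ : Nonempty ((Scheme.Modules.pullback (DualPair.unitHatSlice D₁)).obj D₁.P ≅ SheafOfModules.unit _))
    (hD₂ : Nonempty ((Scheme.Modules.pullback (DualPair.unitHatSlice D₂)).obj D₂.P ≅ SheafOfModules.unit _))
    (hP : E' * P = P) (hlam : g ≫ lam₂ ≫ DualPair.dualIsogenyOver g D₁ D₂ = lam₁) {c : ℕ} (lam₂' : (serreTensor act₂ E' hE').X ⟶ Db₂.hat.X)
    (h₂ : haveI := isMonHom_serreTranslate act₂ E' hE' P
      serreTranslate act₂ E' hE' P ≫ lam₂' ≫ DualPair.dualIsogenyOver (serreTranslate act₂ E' hE' P) D₂ Db₂ = lam₂ ≫ D₂.hat.mulN c) :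
    haveI := isMonHom_serreMap act₁ act₂ E' hE' g
    haveI := isMonHom_serreTranslate act₁ E' hE' P
    serreTranslate act₁ E' hE' P ≫ (serreMap act₁ act₂ E' hE' g ≫ lam₂' ≫ DualPair.dualIsogenyOver (serreMap act₁ act₂ E' hE' g) Db₁ Db₂) ≫
        DualPair.dualIsogenyOver (serreTranslate act₁ E' hE' P) D₁ Db₁ =
      lam₁ ≫ D₁.hat.mulN c := by
  haveI := isMonHom_serreMap act₁ act₂ E' hE' g
  haveI := isMonHom_serreTranslate act₁ E' hE' P
  haveI := isMonHom_serreTranslate act₂ E' hE' P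
  haveI := DualPair.isMonHom_dualIsogenyOver g D₁ D₂ hD₂ hD₁
  have hnat : serreTranslate act₁ E' hE' P ≫ serreMap act₁ act₂ E' hE' g = g ≫ serreTranslate act₂ E' hE' P :=
    serreTranslate_comp_serreMap act₁ act₂ E' hE' P g hg hP
  -- `(g ⊗ 𝔟)^∨ ≫ ψ_P^∨ = ψ_P^∨ ≫ g^∨`
  have hdual : DualPair.dualIsogenyOver (serreMap act₁ act₂ E' hE' g) Db₁ Db₂ ≫ DualPair.dualIsogenyOver (serreTranslate act₁ E' hE' P) D₁ Db₁ =
      DualPair.dualIsogenyOver (serreTranslate act₂ E' hE' P) D₂ Db₂ ≫ DualPair.dualIsogenyOver g D₁ D₂ := by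
    rw [← DualPair.dualIsogenyOver_comp (serreTranslate act₁ E' hE' P) (serreMap act₁ act₂ E' hE' g) D₁ Db₁ Db₂,
      ← DualPair.dualIsogenyOver_comp g (serreTranslate act₂ E' hE' P) D₁ D₂ Db₂]
    exact DualPair.dualIsogenyOver_congr D₁ Db₂ hnat
  -- `[c]` commutes with the homomorphism `g^∨`
  have hc : D₂.hat.mulN c ≫ DualPair.dualIsogenyOver g D₁ D₂ = DualPair.dualIsogenyOver g D₁ D₂ ≫ D₁.hat.mulN c := by
    rw [mulN_def, mulN_def, MonObj.pow_comp, Category.id_comp, MonObj.comp_pow, Category.comp_id]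
  simp only [Category.assoc]
  rw [hdual, ← Category.assoc (serreTranslate act₁ E' hE' P), hnat, Category.assoc, reassoc_of% h₂, hc, ← hlam]
  simp only [Category.assoc]

include hg in
/-- **(iii-exact) in the ★ def currency**: with polarizations `polᵢ` (`g ≫ pol₂.lam ≫ g^∨ = pol₁.lam`), `IsExactTwistPol act₂ … pol₂ c λ₂′ → IsExactTwistPol act₁ … pol₁ c
((g ⊗ 𝔟) ≫ λ₂′ ≫ (g ⊗ 𝔟)^∨)` — so, by ★ `IsExactTwistPol.eq`, `ẽ ≫ λ₂′ ≫ ẽ^∨ = λ₁′` for THE `c`-exact twists on both sides.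
[cite: RapoportSmithlingZhang2020Diagonal, §3.2 and (4.23)] [cite: MumfordAV1970, §23 (Thm. 2, p. 231)] -/
theorem IsExactTwistPol.transport [IsReduced S] [IsLocallyNoetherian S]
    (hD₁ : Nonempty ((Scheme.Modules.pullback (DualPair.unitHatSlice D₁)).obj D₁.P ≅ SheafOfModules.unit _))
    (hD₂ : Nonempty ((Scheme.Modules.pullback (DualPair.unitHatSlice D₂)).obj D₂.P ≅ SheafOfModules.unit _))
    (pol₁ : A₁.Polarization D₁) (pol₂ : A₂.Polarization D₂) (hP : E' * P = P)
    (hlam : g ≫ pol₂.lam ≫ DualPair.dualIsogenyOver g D₁ D₂ = pol₁.lam) {c : ℕ} {lam₂' : (serreTensor act₂ E' hE').X ⟶ Db₂.hat.X}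
    (h₂ : IsExactTwistPol act₂ E' hE' P D₂ Db₂ pol₂ c lam₂') :
    haveI := isMonHom_serreMap act₁ act₂ E' hE' g
    IsExactTwistPol act₁ E' hE' P D₁ Db₁ pol₁ c
      (serreMap act₁ act₂ E' hE' g ≫ lam₂' ≫ DualPair.dualIsogenyOver (serreMap act₁ act₂ E' hE' g) Db₁ Db₂) :=
  isExactTwist_transport act₁ act₂ E' hE' P D₁ D₂ Db₁ Db₂ pol₁.lam pol₂.lam g hg hD₁ hD₂ hP hlam lam₂' h₂

end Polarisation


/-! ### §5 The base-change square: `(ε ⊗ 𝔟)_{S′}` IS `ε_{S′} ⊗ 𝔟` under `(A ⊗_𝒪 𝔟)_{S′} ≅ A_{S′} ⊗_𝒪 𝔟` -/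

section BaseChange

variable {S' : Scheme.{u}} (g : S' ⟶ S) (φ : A₁.X ⟶ A₂.X) [IsMonHom φ]

omit [IsCommMonObj A₁.X] [IsCommMonObj A₂.X] [IsMonHom φ] in
/-- The base change `φ_{S′}` of an `𝒪`-equivariant morphism is equivariant for the base-changed actions (★ `RingAction.baseChange_i`, functoriality of
`Over.pullback g`). [cite: GortzWedhorn2020, Section (4.7) (pp. 107–108)] [cite: Kottwitz1992, §5 (p. 390)] -/
theorem baseChange_map_equivariant (hφ : ∀ a, act₁.i a ≫ φ = φ ≫ act₂.i a) (a : O) :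
    (act₁.baseChange g).i a ≫ ((Over.pullback g).map φ : (A₁.baseChange g).X ⟶ (A₂.baseChange g).X) =
      ((Over.pullback g).map φ : (A₁.baseChange g).X ⟶ (A₂.baseChange g).X) ≫ (act₂.baseChange g).i a := by
  rw [RingAction.baseChange_i, RingAction.baseChange_i]
  change (Over.pullback g).map (act₁.i a) ≫ (Over.pullback g).map φ = (Over.pullback g).map φ ≫ (Over.pullback g).map (act₂.i a)
  rw [← Functor.map_comp, hφ, Functor.map_comp]

omit [IsCommMonObj A₁.X] [IsCommMonObj A₂.X] [IsMonHom φ] in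
/-- **`(φⁿ)_{S′} ≫ powBC = powBC ≫ (φ_{S′})ⁿ`**: the comparison `(Aⁿ)_{S′} ⥲ (A_{S′})ⁿ` (★ `powBC`) is natural in `A` (coordinatewise: `(pr_k)_{S′} ≫ φ_{S′} =
(pr_k ≫ φ)_{S′}`). [cite: GortzWedhorn2020, Section (4.7) (pp. 107–108)] -/
theorem pullback_map_powMap_comp_powBC (n : ℕ) :
    ((Over.pullback g).map (powMap φ n) : ((A₁.pow n).baseChange g).X ⟶ ((A₂.pow n).baseChange g).X) ≫ powBC g A₂ n =
      powBC g A₁ n ≫ powMap ((Over.pullback g).map φ : (A₁.baseChange g).X ⟶ (A₂.baseChange g).X) n := by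
  apply pow_hom_ext
  intro k
  rw [Category.assoc, powBC_powProj, Category.assoc, powMap_powProj, powBC_powProj_assoc]
  change (Over.pullback g).map (powMap φ n) ≫ (Over.pullback g).map (A₂.powProj n k) =
    (Over.pullback g).map (A₁.powProj n k) ≫ (Over.pullback g).map φ
  rw [← Functor.map_comp, powMap_powProj, Functor.map_comp]

/-- **THE BASE-CHANGE SQUARE**: for an `𝒪`-equivariant homomorphism `φ : A₁ → A₂` over `S` and `g : S′ → S`, the base change `(φ ⊗ 𝔟)_{S′}` of its Serre map
corresponds, under the comparison isomorphisms `(Aᵢ ⊗_𝒪 𝔟)_{S′} ⥲ (Aᵢ)_{S′} ⊗_𝒪 𝔟` (★ `serreTensorBaseChangeIso`), to the Serre map `φ_{S′} ⊗ 𝔟` of the base-changed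
homomorphism `φ′ = φ_{S′}` (binder `φ'` with the equation `hφ'`, so that the consumer's own spelling of `φ_{S′} : (A₁)_{S′} → (A₂)_{S′}` is accepted) for the
base-changed actions: `(φ ⊗ 𝔟)_{S′} ≫ iso₂ = iso₁ ≫ (φ′ ⊗ 𝔟)` (check after the monomorphism `ι′`: both sides are `ι_{S′} ≫ (φⁿ)_{S′} ≫ powBC`, ★
`serreTensorBaseChangeIso_hom_ι`, ★ `serreMap_ι`, `pullback_map_powMap_comp_powBC`).  So the structured isomorphism `ε ⊗ 𝔟` of §3 COMMUTES WITH BASE CHANGE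
(generic ∕ special fibre of a model: `g` = the fibre inclusion). [cite: Conrad2004GrossZagier, §7] [cite: GortzWedhorn2020, Section (4.7) (pp. 107–108)] -/
theorem pullback_map_serreMap_comp_serreTensorBaseChangeIso (hφ : ∀ a, act₁.i a ≫ φ = φ ≫ act₂.i a) {n : ℕ} (E : Matrix (Fin n) (Fin n) O)
    (hE : E * E = E) (φ' : (A₁.baseChange g).X ⟶ (A₂.baseChange g).X) [IsMonHom φ'] (hφ' : φ' = (Over.pullback g).map φ) :
    haveI := isCommMonObj_baseChange g (A := A₁)
    haveI := isCommMonObj_baseChange g (A := A₂)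
    ((Over.pullback g).map (serreMap act₁ act₂ E hE φ) :
        ((serreTensor act₁ E hE).baseChange g).X ⟶ ((serreTensor act₂ E hE).baseChange g).X) ≫ (serreTensorBaseChangeIso g act₂ E hE).hom =
      (serreTensorBaseChangeIso g act₁ E hE).hom ≫ serreMap (act₁.baseChange g) (act₂.baseChange g) E hE φ' := by
  haveI := isCommMonObj_baseChange g (A := A₁)
  haveI := isCommMonObj_baseChange g (A := A₂)
  have hφ'eq : ∀ a, (act₁.baseChange g).i a ≫ φ' = φ' ≫ (act₂.baseChange g).i a := by
    rw [hφ']; exact baseChange_map_equivariant act₁ act₂ g φ hφ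
  haveI := (isMonHom_serreι_serreπ (act₂.baseChange g) E hE).2.2
  rw [← cancel_mono (serreι (act₂.baseChange g) E hE), Category.assoc, Category.assoc,
    serreMap_ι (act₁.baseChange g) (act₂.baseChange g) E hE φ' hφ'eq]
  -- `serreι (actᵢ.baseChange g) E hE` IS the `fixedι` of ★ `serreTensorBaseChangeIso_hom_ι` (★ `serreι_baseChange_eq`, `rfl`)
  have h₂ := serreTensorBaseChangeIso_hom_ι g act₂ E hE
  have h₁ := serreTensorBaseChangeIso_hom_ι_assoc g act₁ E hE (powMap φ' n)
  rw [← serreι_baseChange_eq g act₂ E hE] at h₂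
  rw [← serreι_baseChange_eq g act₁ E hE] at h₁
  rw [h₂, h₁]
  subst hφ'
  rw [← pullback_map_powMap_comp_powBC g φ n, ← Category.assoc, ← Category.assoc]
  congr 1
  change (Over.pullback g).map (serreMap act₁ act₂ E hE φ) ≫ (Over.pullback g).map (serreι act₂ E hE) =
    (Over.pullback g).map (serreι act₁ E hE) ≫ (Over.pullback g).map (powMap φ n)
  rw [← Functor.map_comp, serreMap_ι act₁ act₂ E hE φ hφ, Functor.map_comp]

end BaseChange

end AbelianSchemeOver

end Literature.AlgebraicGeometry.AbelianSchemes

end
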